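import Mathlib
import Summits.NavierStokesRegularity.NavierStokesRegularity.Theorems.EulerZoomLiouvillePowerGaugeEulerLiouvilleWeakIntegrableVorticityTools
import Literature.Analysis.FluidPDE.BiotSavartHolderCurl
import Literature.Analysis.FluidPDE.BiotSavartDivCurl
import Literature.Analysis.FunctionSpaces.SobolevDomainProofs
import HarnessLib

/-!
# Crux `EulerZoomLiouville.PowerGaugeEulerLiouville` (stmt-NavierStokesRegularity-19832), weak stratum `stub_selfSimilarWeakRest`:
# EXACTLY SELF-SIMILAR MEMBERS OF ANY REGULARITY WITH INTEGRABLE VORTICITY (`ω ∈ L¹ ∩ L²`) ARE TRIVIAL (`0 < ρ < ½`)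

Route №10 `EulerZoomLiouville` (NavierStokesRegularity), crux E = stmt-NavierStokesRegularity-19832; width seat ns-ezl-w1 g8 under the LEAD
ns-typeII-p2 g14; widening of the weak confined-vorticity member (`…WeakConfinedVorticity`, p690763): the vorticity of the profile need not be confined to
a ball, only INTEGRABLE — `ω̃ = curlCLM ∘ G ∈ L¹(ℝ³) ∩ L^{6/5}(ℝ³)`, in particular `ω̃ ∈ L¹(ℝ³) ∩ L²(ℝ³)` (finite total vorticity and finite enstrophy of the
vortical part).  Then the velocity profile is square integrable on `ℝ³` and the `L²`-profile stratum (`LpProfile`, the easy side of Chae–Shvydkoy's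
window at `q = 2 ≤ 3/(1+ρ)`) kills the member.  Chae–Shvydkoy 2013 Thm 4.1 (`C¹_loc`, `ω ∈ L^p` for one `p < 3γ = 3/(2+ρ)`, strain `o(1)`) is the printed
neighbour; here there is NO regularity and NO strain hypothesis — the class's `A`-gauge supplies the decay ("conjugate through the Sobolev embedding",
as they say: `p = 6/5 ↦ p* = 2`).

Mechanism (`mollify_eq_biotSavart_curl_of_integrableCurl`): for a bump `φ` with `r_φ ≤ 1` the mollification `V_φ = φ ⋆ V` is smooth, divergence free,
of growth `∫_{B_L}|V_φ|² ≤ C 2^θ L^θ`, and its vorticity `W_φ = φ ⋆ ω̃` is `C¹`, integrable, bounded, weakly divergence free; so `K = K₃ ∗ W_φ` is `C¹`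
with `div K = 0`, `curl K = W_φ` (tree `isDivFree_biotSavart_of_contDiff`, `curl_biotSavart_eq_of_isWeaklyDivFree`) and `∫|K|² ≤ C_HLS (∫|W_φ|^{6/5})^{5/3}
≤ C_HLS (∫|ω̃|^{6/5})^{5/3}` (Hardy–Littlewood–Sobolev); the remainder `w = V_φ − K` is `C¹`, curl- and divergence-free with sub-volume growth, hence
ZERO by the WEAK harmonic Liouville theorem `ae_eq_zero_of_symm_traceFree_of_growth` (no `C²` needed).  Thus `∫|V_φ|² ≤ C_HLS(∫|ω̃|^{6/5})^{5/3}`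
UNIFORMLY in `φ` (`lintegral_mollify_sq_le_of_integrableCurl`), and Fatou along an a.e.-convergent mollifier sequence gives `V ∈ L²(ℝ³)`
(`lintegral_sq_lt_top_of_integrableCurl`, `memLp_two_of_integrableCurl`).  Members: `selfSimilar_ae_eq_zero_of_integrableCurl_profile` (origin-centred,
binder shape of `IsExactlySelfSimilar`) and `…_past`.

Binder proposed to the LEAD (over `V`; `E3 = EuclideanSpace ℝ (Fin 3)`):
`∃ G : E3 → E3 →L[ℝ] E3, Literature.Analysis.FunctionSpaces.HasWeakFDerivOn ⊤ volume V G ∧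
  Integrable (fun y => Literature.Analysis.FluidPDE.curlCLM (G y)) volume ∧ MemLp (fun y => Literature.Analysis.FluidPDE.curlCLM (G y)) 2 volume`.
WHAT THIS IS NOT: not NS, not E, not the weak stub — one weak sub-stratum member (`ρ < ½`) `--supports` stmt-19832; 19832 is OPEN.
[folklore; ChaeShvydkoy2013 §4 Thm 4.1 with §3.2 Thm 3.2; Stein1971 Ch. V §1.2 Thm 1; MajdaBertozziCUP2002 §2.4.1 Prop. 2.16]
-/

noncomputable section

-- flat `Theorems/<Route><Decl>…` files of one crux share the namespace of the crux (tree convention)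
set_option linter.dupNamespace false

open MeasureTheory Set Filter Topology Metric Function TopologicalSpace ContinuousLinearMap
open scoped ENNReal NNReal Convolution InnerProductSpace RealInnerProductSpace ContDiff

namespace Summit.NavierStokesRegularity.NavierStokesRegularity.Theorems.PowerGaugeEulerLiouville.WeakConfinedVorticity

open Literature.Analysis Literature.Analysis.FunctionSpaces Literature.Analysis.FluidPDE Literature.Analysis.SingularIntegrals
open Summit.NavierStokesRegularity.NavierStokesRegularity.Theorems.PowerGaugeEulerLiouville

section Representation

variable {V : EuclideanSpace ℝ (Fin 3) → EuclideanSpace ℝ (Fin 3)}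
  {G : EuclideanSpace ℝ (Fin 3) → EuclideanSpace ℝ (Fin 3) →L[ℝ] EuclideanSpace ℝ (Fin 3)}

/-- **A MOLLIFIED WEAK PROFILE WITH INTEGRABLE VORTICITY AND SUB-VOLUME GROWTH IS ITS BIOT–SAVART FIELD.**  `V` with whole-space weak gradient `G`,
weakly divergence free, `ω̃ = curlCLM ∘ G ∈ L¹` with `∫‖ω̃‖^{6/5} < ∞`, growth `∫_{B_L}‖V‖² ≤ C L^θ` for `L ≥ L₀` (`C < ∞`, `0 ≤ θ < 3`); `φ` a bump with
`r_φ ≤ 1`.  Then `φ ⋆ V = K₃ ∗ curl (φ ⋆ V)` everywhere.  (Remainder `C¹`, curl-free, divergence-free, of growth `≲ L^θ` — killed by the WEAK Liouville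
theorem `ae_eq_zero_of_symm_traceFree_of_growth`, then upgraded to everywhere by continuity.) [folklore; MajdaBertozziCUP2002 §2.4.1 Prop. 2.16] -/
theorem mollify_eq_biotSavart_curl_of_integrableCurl (hw : HasWeakFDerivOn (⊤ : Opens (EuclideanSpace ℝ (Fin 3))) volume V G)
    (hdiv : IsWeaklyDivFree V) (hVm : AEStronglyMeasurable V volume)
    (hω1 : Integrable (fun y => curlCLM (G y)) volume)
    (hω65 : ∫⁻ y, ‖curlCLM (G y)‖ₑ ^ (6 / 5 : ℝ) < ⊤)
    {C : ℝ≥0∞} (hC : C ≠ ⊤) {θ L₀ : ℝ} (hθ0 : 0 ≤ θ) (hθ : θ < 3)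
    (hA : ∀ L : ℝ, L₀ ≤ L → ∫⁻ y in ball (0 : EuclideanSpace ℝ (Fin 3)) L, ‖V y‖ₑ ^ 2 ≤ C * ENNReal.ofReal (L ^ θ))
    (φ : ContDiffBump (0 : EuclideanSpace ℝ (Fin 3))) (hφ : φ.rOut ≤ 1) :
    φ.normed volume ⋆[lsmul ℝ ℝ, volume] V = biotSavart (curl (φ.normed volume ⋆[lsmul ℝ ℝ, volume] V)) := by
  set Vφ := φ.normed volume ⋆[lsmul ℝ ℝ, volume] V with hVφ
  have hVs : ContDiff ℝ ∞ Vφ := contDiff_mollify hw φ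
  have hV1 : ContDiff ℝ 1 Vφ := hVs.of_le (by norm_cast)
  have hVd : Differentiable ℝ Vφ := hV1.differentiable_one
  set W : EuclideanSpace ℝ (Fin 3) → EuclideanSpace ℝ (Fin 3) := curl Vφ with hWdef
  obtain ⟨hWint, ⟨M, hM⟩, hWc⟩ := curl_mollify_integrable_bounded hw hω1 φ
  have hW1 : ContDiff ℝ 1 W := contDiff_one_curl_mollify hw φ
  have hWdiv : IsWeaklyDivFree W := isWeaklyDivFree_curl_mollify hw φ
  set K : EuclideanSpace ℝ (Fin 3) → EuclideanSpace ℝ (Fin 3) := biotSavart W with hKdef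
  have hK1 : ContDiff ℝ 1 K := contDiff_biotSavart_of_contDiff hW1 hWint hM
  have hKd : Differentiable ℝ K := hK1.differentiable_one
  have hdivK : VectorCalculus.IsDivFree K := isDivFree_biotSavart_of_contDiff hWc hWint hM hK1
  have hcurlK : curl K = W := curl_biotSavart_eq_of_isWeaklyDivFree hWc hWint hM hWdiv hK1
  -- ### the remainder
  set w : EuclideanSpace ℝ (Fin 3) → EuclideanSpace ℝ (Fin 3) := fun y => Vφ y - K y with hwdef
  have hw1 : ContDiff ℝ 1 w := hV1.sub hK1
  have hcurlw : ∀ x, curl w x = 0 := fun x => by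
    rw [hwdef, curl_sub (hVd x) (hKd x), hcurlK, hWdef, sub_self]
  have hdivw : VectorCalculus.IsDivFree w := fun x => by
    unfold VectorCalculus.divergence
    rw [hwdef, fderiv_fun_sub (hVd x) (hKd x), ContinuousLinearMap.toLinearMap_sub, map_sub]
    have h1 := isDivFree_mollify hw hdiv φ x
    have h2 := hdivK x
    unfold VectorCalculus.divergence at h1 h2
    rw [h1, h2, sub_self]
  have hwG : HasWeakGradient w (fderiv ℝ w) :=
    HasWeakFDerivOn.of_contDiff_holds (⊤ : Opens (EuclideanSpace ℝ (Fin 3))) volume hw1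
  have hsym : ∀ᵐ x ∂(volume : Measure (EuclideanSpace ℝ (Fin 3))),
      ∀ v u : EuclideanSpace ℝ (Fin 3), ⟪fderiv ℝ w x v, u⟫ = ⟪fderiv ℝ w x u, v⟫ :=
    Eventually.of_forall fun x => symm_of_curlCLM_eq_zero (by rw [← curl_eq_curlCLM]; exact hcurlw x)
  have htr : ∀ᵐ x ∂(volume : Measure (EuclideanSpace ℝ (Fin 3))),
      ∑ j, fderiv ℝ w x (EuclideanSpace.single j (1 : ℝ)) j = 0 := by
    refine Eventually.of_forall fun x => ?_
    have h := hdivw x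
    rw [divergence_eq_sum_inner_fderiv (EuclideanSpace.basisFun (Fin 3) ℝ)] at h
    simpa [EuclideanSpace.basisFun_apply, EuclideanSpace.inner_single_left] using h
  -- ### the energy of `K` (Hardy–Littlewood–Sobolev)
  obtain ⟨CH, hCH, HLS⟩ := lintegral_biotSavart_sq_le
  set EK : ℝ≥0∞ := CH * (∫⁻ y, ‖curlCLM (G y)‖ₑ ^ (6 / 5 : ℝ)) ^ (5 / 3 : ℝ) with hEKdef
  have hEK : ∫⁻ x, ‖K x‖ₑ ^ 2 ≤ EK :=
    calc ∫⁻ x, ‖K x‖ₑ ^ 2 ≤ CH * (∫⁻ y, ‖W y‖ₑ ^ (6 / 5 : ℝ)) ^ (5 / 3 : ℝ) := HLS W hWc.aestronglyMeasurable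
      _ ≤ EK := by
          refine mul_le_mul' le_rfl (ENNReal.rpow_le_rpow ?_ (by norm_num))
          rw [hWdef, hVφ, curl_mollify_eq_mollify_curlCLM hw φ]
          exact lintegral_rpow_sixFifths_mollify_le φ hω1.aestronglyMeasurable
  have hEKtop : EK ≠ ⊤ :=
    ENNReal.mul_ne_top hCH.ne (ENNReal.rpow_ne_top_of_nonneg (by norm_num) hω65.ne)
  -- ### growth of the remainder
  set Kc : ℝ≥0∞ := 2 * (C * ENNReal.ofReal (2 ^ θ)) + 2 * EK with hKc
  have hKctop : Kc ≠ ⊤ := ENNReal.add_ne_top.2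
    ⟨ENNReal.mul_ne_top ENNReal.ofNat_ne_top (ENNReal.mul_ne_top hC ENNReal.ofReal_ne_top),
      ENNReal.mul_ne_top ENNReal.ofNat_ne_top hEKtop⟩
  have hpt : ∀ y, ‖w y‖ₑ ^ 2 ≤ 2 * ‖Vφ y‖ₑ ^ 2 + 2 * ‖K y‖ₑ ^ 2 := by
    intro y
    have h : ‖Vφ y - K y‖ ^ 2 ≤ 2 * ‖Vφ y‖ ^ 2 + 2 * ‖K y‖ ^ 2 :=
      calc ‖Vφ y - K y‖ ^ 2 ≤ (‖Vφ y‖ + ‖K y‖) ^ 2 := pow_le_pow_left₀ (norm_nonneg _) (norm_sub_le _ _) 2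
        _ ≤ 2 * ‖Vφ y‖ ^ 2 + 2 * ‖K y‖ ^ 2 := by nlinarith [sq_nonneg (‖Vφ y‖ - ‖K y‖)]
    calc ‖w y‖ₑ ^ 2 = ENNReal.ofReal (‖Vφ y - K y‖ ^ 2) := by
          rw [hwdef, ← ofReal_norm, ENNReal.ofReal_pow (norm_nonneg _)]
      _ ≤ ENNReal.ofReal (2 * ‖Vφ y‖ ^ 2 + 2 * ‖K y‖ ^ 2) := ENNReal.ofReal_le_ofReal h
      _ = 2 * ‖Vφ y‖ₑ ^ 2 + 2 * ‖K y‖ₑ ^ 2 := by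
          rw [ENNReal.ofReal_add (by positivity) (by positivity), ENNReal.ofReal_mul zero_le_two,
            ENNReal.ofReal_mul zero_le_two, ENNReal.ofReal_pow (norm_nonneg _), ENNReal.ofReal_pow (norm_nonneg _),
            ofReal_norm, ofReal_norm, ENNReal.ofReal_ofNat]
  have hgrowth : ∀ r : ℝ, max L₀ 1 < r → 0 < r →
      ∫⁻ x in ball (0 : EuclideanSpace ℝ (Fin 3)) r, ‖w x‖ₑ ^ 2 ≤ ENNReal.ofReal (Kc.toReal * r ^ θ) := by
    intro r hr hr0
    have hr1 : 1 ≤ r := le_of_lt (lt_of_le_of_lt (le_max_right _ _) hr)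
    have hrL : L₀ ≤ 2 * r := by linarith [le_max_left L₀ 1]
    have hsub : ball (0 : EuclideanSpace ℝ (Fin 3)) (r + φ.rOut) ⊆ ball 0 (2 * r) := ball_subset_ball (by linarith)
    have hVr : ∫⁻ y in ball (0 : EuclideanSpace ℝ (Fin 3)) r, ‖Vφ y‖ₑ ^ 2 ≤ C * ENNReal.ofReal (2 ^ θ) * ENNReal.ofReal (r ^ θ) :=
      calc ∫⁻ y in ball (0 : EuclideanSpace ℝ (Fin 3)) r, ‖Vφ y‖ₑ ^ 2
          ≤ ∫⁻ y in ball (0 : EuclideanSpace ℝ (Fin 3)) (r + φ.rOut), ‖V y‖ₑ ^ 2 := lintegral_ball_mollify_sq_le hVm φ r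
        _ ≤ ∫⁻ y in ball (0 : EuclideanSpace ℝ (Fin 3)) (2 * r), ‖V y‖ₑ ^ 2 := lintegral_mono_set hsub
        _ ≤ C * ENNReal.ofReal ((2 * r) ^ θ) := hA (2 * r) hrL
        _ = C * ENNReal.ofReal (2 ^ θ) * ENNReal.ofReal (r ^ θ) := by
            rw [Real.mul_rpow zero_le_two hr0.le, ENNReal.ofReal_mul (by positivity), mul_assoc]
    have hKm : AEMeasurable (fun y => ‖K y‖ₑ ^ 2) (volume.restrict (ball (0 : EuclideanSpace ℝ (Fin 3)) r)) :=
      (hK1.continuous.aestronglyMeasurable.enorm.pow_const 2).restrict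
    have h1θ : (1 : ℝ≥0∞) ≤ ENNReal.ofReal (r ^ θ) := by
      rw [← ENNReal.ofReal_one]; exact ENNReal.ofReal_le_ofReal (Real.one_le_rpow hr1 hθ0)
    calc ∫⁻ x in ball (0 : EuclideanSpace ℝ (Fin 3)) r, ‖w x‖ₑ ^ 2
        ≤ ∫⁻ x in ball (0 : EuclideanSpace ℝ (Fin 3)) r, (2 * ‖Vφ x‖ₑ ^ 2 + 2 * ‖K x‖ₑ ^ 2) := lintegral_mono fun y => hpt y
      _ = (2 * ∫⁻ x in ball (0 : EuclideanSpace ℝ (Fin 3)) r, ‖Vφ x‖ₑ ^ 2) +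
            2 * ∫⁻ x in ball (0 : EuclideanSpace ℝ (Fin 3)) r, ‖K x‖ₑ ^ 2 := by
          rw [lintegral_add_right' _ (hKm.const_mul _), lintegral_const_mul' _ _ ENNReal.ofNat_ne_top,
            lintegral_const_mul'' _ hKm]
      _ ≤ 2 * (C * ENNReal.ofReal (2 ^ θ) * ENNReal.ofReal (r ^ θ)) + 2 * EK :=
          add_le_add (mul_le_mul' le_rfl hVr) (mul_le_mul' le_rfl ((setLIntegral_le_lintegral _ _).trans hEK))
      _ ≤ 2 * (C * ENNReal.ofReal (2 ^ θ) * ENNReal.ofReal (r ^ θ)) + 2 * EK * ENNReal.ofReal (r ^ θ) := by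
          have h2 : 2 * EK ≤ 2 * EK * ENNReal.ofReal (r ^ θ) :=
            calc 2 * EK = 2 * EK * 1 := (mul_one _).symm
              _ ≤ 2 * EK * ENNReal.ofReal (r ^ θ) := mul_le_mul' le_rfl h1θ
          exact add_le_add le_rfl h2
      _ = Kc * ENNReal.ofReal (r ^ θ) := by rw [hKc]; ring
      _ = ENNReal.ofReal (Kc.toReal * r ^ θ) := by
          rw [ENNReal.ofReal_mul ENNReal.toReal_nonneg, ENNReal.ofReal_toReal hKctop]
  -- ### weak Liouville and continuity
  have hw0 : w =ᵐ[volume] 0 :=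
    ae_eq_zero_of_symm_traceFree_of_growth hwG hsym htr (K := Kc.toReal) (m := θ) (r₀ := max L₀ 1) hθ hgrowth
  have hw00 : w = 0 := (hw1.continuous.ae_eq_iff_eq volume continuous_const).1 hw0
  funext y
  have := congrFun hw00 y
  simp only [hwdef, Pi.zero_apply, sub_eq_zero] at this
  exact this

/-- **UNIFORM `L²` BOUND FOR THE MOLLIFICATIONS**: under the hypotheses of `mollify_eq_biotSavart_curl_of_integrableCurl`,
`∫‖φ ⋆ V‖² ≤ C_HLS (∫‖ω̃‖^{6/5})^{5/3}` for every bump with `r_φ ≤ 1` — a bound independent of `φ`. [folklore; Stein1971 Ch. V §1.2 Thm 1] -/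
theorem lintegral_mollify_sq_le_of_integrableCurl (hw : HasWeakFDerivOn (⊤ : Opens (EuclideanSpace ℝ (Fin 3))) volume V G)
    (hdiv : IsWeaklyDivFree V) (hVm : AEStronglyMeasurable V volume)
    (hω1 : Integrable (fun y => curlCLM (G y)) volume)
    (hω65 : ∫⁻ y, ‖curlCLM (G y)‖ₑ ^ (6 / 5 : ℝ) < ⊤)
    {C : ℝ≥0∞} (hC : C ≠ ⊤) {θ L₀ : ℝ} (hθ0 : 0 ≤ θ) (hθ : θ < 3)
    (hA : ∀ L : ℝ, L₀ ≤ L → ∫⁻ y in ball (0 : EuclideanSpace ℝ (Fin 3)) L, ‖V y‖ₑ ^ 2 ≤ C * ENNReal.ofReal (L ^ θ)) :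
    ∃ B : ℝ≥0∞, B ≠ ⊤ ∧ ∀ φ : ContDiffBump (0 : EuclideanSpace ℝ (Fin 3)), φ.rOut ≤ 1 →
      ∫⁻ x, ‖(φ.normed volume ⋆[lsmul ℝ ℝ, volume] V) x‖ₑ ^ 2 ≤ B := by
  obtain ⟨CH, hCH, HLS⟩ := lintegral_biotSavart_sq_le
  refine ⟨CH * (∫⁻ y, ‖curlCLM (G y)‖ₑ ^ (6 / 5 : ℝ)) ^ (5 / 3 : ℝ),
    ENNReal.mul_ne_top hCH.ne (ENNReal.rpow_ne_top_of_nonneg (by norm_num) hω65.ne), fun φ hφ => ?_⟩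
  have hrep := mollify_eq_biotSavart_curl_of_integrableCurl hw hdiv hVm hω1 hω65 hC hθ0 hθ hA φ hφ
  obtain ⟨-, -, hWc⟩ := curl_mollify_integrable_bounded hw hω1 φ
  have h1 := HLS (curl (φ.normed volume ⋆[lsmul ℝ ℝ, volume] V)) hWc.aestronglyMeasurable
  rw [← hrep] at h1
  refine h1.trans (mul_le_mul' le_rfl (ENNReal.rpow_le_rpow ?_ (by norm_num)))
  rw [curl_mollify_eq_mollify_curlCLM hw φ]
  exact lintegral_rpow_sixFifths_mollify_le φ hω1.aestronglyMeasurable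

/-- **A WEAK PROFILE WITH INTEGRABLE VORTICITY AND SUB-VOLUME GROWTH HAS FINITE ENERGY**: `∫‖V‖² < ∞` (Fatou along an a.e.-convergent mollifier
sequence, tree `FunctionSpaces.ae_tendsto_normed_convolution`, with the uniform bound `lintegral_mollify_sq_le_of_integrableCurl`). [folklore] -/
theorem lintegral_sq_lt_top_of_integrableCurl (hw : HasWeakFDerivOn (⊤ : Opens (EuclideanSpace ℝ (Fin 3))) volume V G)
    (hdiv : IsWeaklyDivFree V) (hVm : AEStronglyMeasurable V volume)
    (hω1 : Integrable (fun y => curlCLM (G y)) volume)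
    (hω65 : ∫⁻ y, ‖curlCLM (G y)‖ₑ ^ (6 / 5 : ℝ) < ⊤)
    {C : ℝ≥0∞} (hC : C ≠ ⊤) {θ L₀ : ℝ} (hθ0 : 0 ≤ θ) (hθ : θ < 3)
    (hA : ∀ L : ℝ, L₀ ≤ L → ∫⁻ y in ball (0 : EuclideanSpace ℝ (Fin 3)) L, ‖V y‖ₑ ^ 2 ≤ C * ENNReal.ofReal (L ^ θ)) :
    ∫⁻ x, ‖V x‖ₑ ^ 2 < ⊤ := by
  obtain ⟨B, hB, hbound⟩ := lintegral_mollify_sq_le_of_integrableCurl hw hdiv hVm hω1 hω65 hC hθ0 hθ hA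
  have hVl : LocallyIntegrable V volume := locallyIntegrableOn_univ.1 (by
    simpa only [Opens.coe_top] using hw.locallyIntegrableOn)
  obtain ⟨φ, hφ0, hφ2⟩ := exists_contDiffBump_seq (E := EuclideanSpace ℝ (Fin 3))
  have hsmall : ∀ᶠ n in atTop, (φ n).rOut ≤ 1 :=
    (hφ0.eventually (gt_mem_nhds one_pos)).mono fun n hn => hn.le
  set f : ℕ → EuclideanSpace ℝ (Fin 3) → ℝ≥0∞ := fun n x => ‖((φ n).normed volume ⋆[lsmul ℝ ℝ, volume] V) x‖ₑ ^ 2 with hf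
  have hfm : ∀ n, AEMeasurable (f n) volume := fun n =>
    ((contDiff_mollify hw (φ n)).continuous.aestronglyMeasurable.enorm.pow_const 2)
  have hlim : ∀ᵐ x ∂(volume : Measure (EuclideanSpace ℝ (Fin 3))), liminf (fun n => f n x) atTop = ‖V x‖ₑ ^ 2 := by
    filter_upwards [ae_tendsto_normed_convolution hφ0 hφ2 hVl] with x hx
    have h1 : Tendsto (fun n => ENNReal.ofReal ‖((φ n).normed volume ⋆[lsmul ℝ ℝ, volume] V) x‖) atTop
        (𝓝 (ENNReal.ofReal ‖V x‖)) := ENNReal.tendsto_ofReal hx.norm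
    simp only [ofReal_norm] at h1
    have h2 : Tendsto (fun n => f n x) atTop (𝓝 (‖V x‖ₑ ^ 2)) :=
      ((ENNReal.continuous_pow 2).tendsto _).comp h1
    exact h2.liminf_eq
  calc ∫⁻ x, ‖V x‖ₑ ^ 2 = ∫⁻ x, liminf (fun n => f n x) atTop := lintegral_congr_ae (by
          filter_upwards [hlim] with x hx; exact hx.symm)
    _ ≤ liminf (fun n => ∫⁻ x, f n x) atTop := lintegral_liminf_le' hfm
    _ ≤ B := liminf_le_of_frequently_le' ((hsmall.mono fun n hn => hbound (φ n) hn).frequently)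
    _ < ⊤ := hB.lt_top

/-- **`V ∈ L²(ℝ³)`** for a weak profile with integrable vorticity (`ω̃ ∈ L¹`, `∫‖ω̃‖^{6/5} < ∞`) and sub-volume growth. [folklore] -/
theorem memLp_two_of_integrableCurl (hw : HasWeakFDerivOn (⊤ : Opens (EuclideanSpace ℝ (Fin 3))) volume V G)
    (hdiv : IsWeaklyDivFree V) (hVm : AEStronglyMeasurable V volume)
    (hω1 : Integrable (fun y => curlCLM (G y)) volume)
    (hω65 : ∫⁻ y, ‖curlCLM (G y)‖ₑ ^ (6 / 5 : ℝ) < ⊤)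
    {C : ℝ≥0∞} (hC : C ≠ ⊤) {θ L₀ : ℝ} (hθ0 : 0 ≤ θ) (hθ : θ < 3)
    (hA : ∀ L : ℝ, L₀ ≤ L → ∫⁻ y in ball (0 : EuclideanSpace ℝ (Fin 3)) L, ‖V y‖ₑ ^ 2 ≤ C * ENNReal.ofReal (L ^ θ)) :
    MemLp V 2 volume := by
  refine ⟨hVm, ?_⟩
  rw [eLpNorm_lt_top_iff_lintegral_rpow_enorm_lt_top two_ne_zero ENNReal.ofNat_ne_top]
  have h := lintegral_sq_lt_top_of_integrableCurl hw hdiv hVm hω1 hω65 hC hθ0 hθ hA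
  have e : ∫⁻ x, ‖V x‖ₑ ^ ((2 : ℝ≥0∞).toReal) = ∫⁻ x, ‖V x‖ₑ ^ 2 :=
    lintegral_congr fun x => by rw [ENNReal.toReal_ofNat, ENNReal.rpow_two]
  rwa [e]

end Representation

/-! ### Member level -/

section Member

/-- **INTEGRABLE VORTICITY, ORIGIN-CENTRED MEMBER** (`0 < ρ < ½`; crux hypotheses verbatim, binder shape of the skeleton's `IsExactlySelfSimilar`): an exactly
self-similar member of the class whose velocity profile `V` — of ANY regularity — has a whole-space weak gradient `G` with INTEGRABLE, SQUARE-INTEGRABLE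
vorticity `curlCLM ∘ G ∈ L¹(ℝ³) ∩ L²(ℝ³)` is trivial (`Past.profileData_of_past` for measurability / weak incompressibility / `A`-growth ⇒
`memLp_two_of_integrableCurl` ⇒ `LpProfile.selfSimilar_ae_eq_zero_of_memLp_profile'` at `q = 2`). [folklore; ChaeShvydkoy2013 §4 Thm 4.1 with §3.2 Thm 3.2] -/
theorem selfSimilar_ae_eq_zero_of_integrableCurl_profile {ρ : ℝ} (hρ : 0 < ρ) (hρ2 : ρ < 1 / 2)
    {u : ℝ → EuclideanSpace ℝ (Fin 3) → EuclideanSpace ℝ (Fin 3)} {p : ℝ → EuclideanSpace ℝ (Fin 3) → ℝ}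
    {H : ℝ → EuclideanSpace ℝ (Fin 3) → EuclideanSpace ℝ (Fin 3) →L[ℝ] EuclideanSpace ℝ (Fin 3)} {c : ℝ≥0}
    (hsw : IsSuitableWeakSolutionOn (slab (EuclideanSpace ℝ (Fin 3)) (Iio 0) isOpen_Iio) 0 0 u p)
    (hH : HasWeakSpatialGradientOn (slab (EuclideanSpace ℝ (Fin 3)) (Iio 0) isOpen_Iio) u H)
    (hgauge : ∀ a : ℝ, 0 < a →
      ENNReal.ofReal (a ^ (2 * ρ)) * cknA a (0 : ℝ × EuclideanSpace ℝ (Fin 3)) u +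
          ENNReal.ofReal (a ^ ρ) * cknE a (0 : ℝ × EuclideanSpace ℝ (Fin 3)) H +
        ENNReal.ofReal (a ^ (2 * ρ)) * cknD a (0 : ℝ × EuclideanSpace ℝ (Fin 3)) p ≤ (c : ℝ≥0∞))
    {V : EuclideanSpace ℝ (Fin 3) → EuclideanSpace ℝ (Fin 3)} {P : EuclideanSpace ℝ (Fin 3) → ℝ}
    (hu : ∀ τ : ℝ, τ < 0 → u τ = selfSimilarCollapse (1 / (2 + ρ)) 0 V τ)
    (hp : ∀ τ : ℝ, τ < 0 → p τ = selfSimilarCollapsePressure (1 / (2 + ρ)) 0 P τ)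
    {G : EuclideanSpace ℝ (Fin 3) → EuclideanSpace ℝ (Fin 3) →L[ℝ] EuclideanSpace ℝ (Fin 3)}
    (hVG : HasWeakFDerivOn (⊤ : Opens (EuclideanSpace ℝ (Fin 3))) volume V G)
    (hω1 : Integrable (fun y => curlCLM (G y)) volume) (hω2 : MemLp (fun y => curlCLM (G y)) 2 volume) :
    uncurry u =ᵐ[volume.restrict (Iio (0 : ℝ) ×ˢ (univ : Set (EuclideanSpace ℝ (Fin 3))))] 0 := by
  have hA : ∀ a : ℝ, 0 < a → ENNReal.ofReal (a ^ (2 * ρ)) *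
      cknA a (0 : ℝ × EuclideanSpace ℝ (Fin 3)) u ≤ (c : ℝ≥0∞) :=
    fun a ha => le_trans (le_trans le_self_add le_self_add) (hgauge a ha)
  have hE : ∀ a : ℝ, 0 < a → ENNReal.ofReal (a ^ ρ) *
      cknE a (0 : ℝ × EuclideanSpace ℝ (Fin 3)) H ≤ (c : ℝ≥0∞) :=
    fun a ha => le_trans (le_trans le_add_self le_self_add) (hgauge a ha)
  have hD : ∀ a : ℝ, 0 < a → ENNReal.ofReal (a ^ (2 * ρ)) *
      cknD a (0 : ℝ × EuclideanSpace ℝ (Fin 3)) p ≤ (c : ℝ≥0∞) :=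
    fun a ha => le_trans le_add_self (hgauge a ha)
  have hu' : ∀ τ : ℝ, τ < 0 → u τ = fun x => selfSimilarCollapse (1 / (2 + ρ)) 0 V τ (x - 0) :=
    fun τ hτ => by rw [hu τ hτ]; funext x; rw [sub_zero]
  have hp' : ∀ τ : ℝ, τ < 0 → p τ = fun x => selfSimilarCollapsePressure (1 / (2 + ρ)) 0 P τ (x - 0) :=
    fun τ hτ => by rw [hp τ hτ]; funext x; rw [sub_zero]
  obtain ⟨G', hVm, -, -, -, -, ⟨CA, hCA, hAgr⟩, -, -, -, -, -, hdivV, -, -, -⟩ :=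
    Past.profileData_of_past hρ hρ2.le le_rfl le_rfl 0 hsw.distributional hH hA hE hD hu' hp'
  have hω65 := lintegral_rpow_sixFifths_lt_top hω1 hω2
  have hmem := memLp_two_of_integrableCurl hVG hdivV hVm hω1 hω65 hCA (θ := 1 - 2 * ρ) (L₀ := 2 - 0)
    (by linarith) (by linarith) hAgr
  have hq : (2 : ℝ) ≤ 3 / (1 + ρ) := by
    rw [le_div_iff₀ (by linarith)]
    linarith
  have hmem' : MemLp V (ENNReal.ofReal 2) volume := by rwa [ENNReal.ofReal_ofNat]
  exact LpProfile.selfSimilar_ae_eq_zero_of_memLp_profile' hρ hρ2 hsw hH hgauge hu hp le_rfl hq hmem'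

/-- **INTEGRABLE VORTICITY, PAST/SHIFTED MEMBER** (`0 < ρ < ½`): a member exactly self-similar about `(T, x₀)` for `τ < T₁` (`T₁ ≤ 0`, `T₁ ≤ T`) whose velocity
profile has a whole-space weak gradient with vorticity in `L¹(ℝ³) ∩ L²(ℝ³)` is trivial. [folklore; ChaeShvydkoy2013 §4 Thm 4.1 with §3.2 Thm 3.2] -/
theorem selfSimilar_ae_eq_zero_of_integrableCurl_profile_past {ρ : ℝ} (hρ : 0 < ρ) (hρ2 : ρ < 1 / 2)
    {T T₁ : ℝ} (hT₁ : T₁ ≤ 0) (hTT₁ : T₁ ≤ T) (x₀ : EuclideanSpace ℝ (Fin 3))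
    {u : ℝ → EuclideanSpace ℝ (Fin 3) → EuclideanSpace ℝ (Fin 3)} {p : ℝ → EuclideanSpace ℝ (Fin 3) → ℝ}
    {H : ℝ → EuclideanSpace ℝ (Fin 3) → EuclideanSpace ℝ (Fin 3) →L[ℝ] EuclideanSpace ℝ (Fin 3)} {c : ℝ≥0}
    (hsw : IsSuitableWeakSolutionOn (slab (EuclideanSpace ℝ (Fin 3)) (Iio 0) isOpen_Iio) 0 0 u p)
    (hH : HasWeakSpatialGradientOn (slab (EuclideanSpace ℝ (Fin 3)) (Iio 0) isOpen_Iio) u H)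
    (hgauge : ∀ a : ℝ, 0 < a →
      ENNReal.ofReal (a ^ (2 * ρ)) * cknA a (0 : ℝ × EuclideanSpace ℝ (Fin 3)) u +
          ENNReal.ofReal (a ^ ρ) * cknE a (0 : ℝ × EuclideanSpace ℝ (Fin 3)) H +
        ENNReal.ofReal (a ^ (2 * ρ)) * cknD a (0 : ℝ × EuclideanSpace ℝ (Fin 3)) p ≤ (c : ℝ≥0∞))
    {V : EuclideanSpace ℝ (Fin 3) → EuclideanSpace ℝ (Fin 3)} {P : EuclideanSpace ℝ (Fin 3) → ℝ}
    (hu : ∀ τ : ℝ, τ < T₁ → u τ = fun x => selfSimilarCollapse (1 / (2 + ρ)) T V τ (x - x₀))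
    (hp : ∀ τ : ℝ, τ < T₁ → p τ = fun x => selfSimilarCollapsePressure (1 / (2 + ρ)) T P τ (x - x₀))
    {G : EuclideanSpace ℝ (Fin 3) → EuclideanSpace ℝ (Fin 3) →L[ℝ] EuclideanSpace ℝ (Fin 3)}
    (hVG : HasWeakFDerivOn (⊤ : Opens (EuclideanSpace ℝ (Fin 3))) volume V G)
    (hω1 : Integrable (fun y => curlCLM (G y)) volume) (hω2 : MemLp (fun y => curlCLM (G y)) 2 volume) :
    uncurry u =ᵐ[volume.restrict (Iio (0 : ℝ) ×ˢ (univ : Set (EuclideanSpace ℝ (Fin 3))))] 0 := by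
  have hA : ∀ a : ℝ, 0 < a → ENNReal.ofReal (a ^ (2 * ρ)) *
      cknA a (0 : ℝ × EuclideanSpace ℝ (Fin 3)) u ≤ (c : ℝ≥0∞) :=
    fun a ha => le_trans (le_trans le_self_add le_self_add) (hgauge a ha)
  have hE : ∀ a : ℝ, 0 < a → ENNReal.ofReal (a ^ ρ) *
      cknE a (0 : ℝ × EuclideanSpace ℝ (Fin 3)) H ≤ (c : ℝ≥0∞) :=
    fun a ha => le_trans (le_trans le_add_self le_self_add) (hgauge a ha)
  have hD : ∀ a : ℝ, 0 < a → ENNReal.ofReal (a ^ (2 * ρ)) *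
      cknD a (0 : ℝ × EuclideanSpace ℝ (Fin 3)) p ≤ (c : ℝ≥0∞) :=
    fun a ha => le_trans le_add_self (hgauge a ha)
  obtain ⟨G', hVm, -, -, -, -, ⟨CA, hCA, hAgr⟩, -, -, -, -, -, hdivV, -, -, -⟩ :=
    Past.profileData_of_past hρ hρ2.le hT₁ hTT₁ x₀ hsw.distributional hH hA hE hD hu hp
  have hω65 := lintegral_rpow_sixFifths_lt_top hω1 hω2
  have hmem := memLp_two_of_integrableCurl hVG hdivV hVm hω1 hω65 hCA (θ := 1 - 2 * ρ) (L₀ := 2 - T₁)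
    (by linarith) (by linarith) hAgr
  have hq : (2 : ℝ) ≤ 3 / (1 + ρ) := by
    rw [le_div_iff₀ (by linarith)]
    linarith
  have hmem' : MemLp V (ENNReal.ofReal 2) volume := by rwa [ENNReal.ofReal_ofNat]
  exact LpProfile.selfSimilar_ae_eq_zero_of_memLp_profile_past' hρ hρ2 hT₁ hTT₁ x₀ hsw hH hgauge hu hp le_rfl hq hmem'

end Member

end Summit.NavierStokesRegularity.NavierStokesRegularity.Theorems.PowerGaugeEulerLiouville.WeakConfinedVorticity

end
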